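import Literature.MathematicalPhysics.QuantumFieldTheory.Balaban1983to89.Node00.CarriersB10

/-!
# NODE 00 (YM-PLAN Track A) — THE PRIMED [B10] SLOT `PrintedUV3V'` (chair R451: N08's count path (R-b)) BESIDE the slot of record `PrintedUV3V`: [Balaban1985UV3]
# Thm 1 (compact) ∧ Thm 2 along SOME averaging of Bałaban's PRINTED AXIOMATIC CLASS — typed at the level print itself axiomatizes, the small-loop average `M` of
# [Balaban1987RG1] (0.5)–(0.9) p. 253 with its LINEARIZATION (0.8) as the one substantive field —, SOME version of (10) along it, print's [B11] minimisers READ AT it;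
# `PrintedUV3V → PrintedUV3V'` by ∃-introduction at print's own `exp[mean log]` average, whose (0.8) is a kernel theorem

NODE 00 CARRIER MODULE (seat `pub-ymgap-node00-def` g31, 2026-08-26), the definer lineage's TYPE of seat dag-n08-a g6's draft `HOME/pub-ymgap-dag-n08-a/N08-PRIMED-SLOT-DRAFT.md`
(73226961b9a3925c; (P1)–(P4)) under the pub-ymgap chair's ruling R451 (INBOX l.11592: (R-b) IS the record's reading of N08's count path; (C1) the admissibility predicate lists
EXACTLY the printed axioms with locators — no measurability field, no E6′; (C2) NO re-point: S1 `PrintedUV3V` stays, the primed slot sits BESIDE it with `PrintedUV3V → PrintedUV3V′`;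
(E) «n08-a drafts, the definer lineage types-or-vetoes BY NAME») and this seat's WORD-B10′ (INBOX l.11726).  APPEND-ONLY: a NEW importing module; `CarriersB10` (S1), n08-a's
`B10RunsOfRecord` v1.2 §9∕§9′ (`runObjects₀A`, `Backgrounds.ofAvg` and their `rfl` bridges to §8), the b2b-balaban lineage's `BlockAveraging` ∕ `BlockAveragingExpMeanLog`
(`LoopAverage`, `blockAvgStd`, `expMeanLogSU`, `coe_expMeanLogSU_E`) and lit-balaban's `MatrixLog` ∕ `B7BlockAvgLog` (`mlog`, `mlog_exp`, (26)) untouched and CONSUMED BY NAME.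
[Balaban1985UV3] = T. Bałaban, *Ultraviolet stability of three-dimensional lattice pure gauge field theories*, Commun. Math. Phys. **102** (1985) 255–275 (cell paper B10);
[Balaban1987RG1] = Commun. Math. Phys. **109** (1987) 249–301 (B12); [Balaban1985Averaging] = Commun. Math. Phys. **98** (1985) 17–51 (B7).

WHAT IS DEFINED.  (P1) `AvgFamily₃ N L := ∀ S : Scales L, ∀ j, Averaging S.P j (SU N)` — the class print quantifies over ([Balaban1985UV3] p. 256 L10 «T described in [1,4]»; gauge
covariance (11) and locality are FIELDS of `Setup.Averaging`, so structural); (P2) `TFamilyA₃ N 𝔞 := ∀ S j, RTOpI S.P j (SU N) (𝔞 S j)` (`TFamily₃ = TFamilyA₃ (avOfPrint N)`, `rfl`);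
`avOfLoop N L ℰ` = the (0.4)-SHAPE family `blockAvgStd S.P (SU N) ℰ` of a small-loop average `ℰ : LoopAverage (SU N)` (`avOfLoop expMeanLogSU = avOfPrint`, `rfl`); (P3) THE ADMISSIBILITY
PREDICATE `AvgAdmissible₃ N 𝔞 := ∃ ℰ, LoopLinearised N ℰ ∧ 𝔞 = avOfLoop N L ℰ` with `LoopLinearised` = [Balaban1987RG1] (0.8) p. 253 LINEARIZATION, first order, in the
principal-logarithm chart («(1/i) log M({exp iA_j}) = (1/n) Σ A_j + (higher order terms)»: for every `ε > 0` a `δ > 0` with `‖(1/i) log ℰ{U_j} − (1/n) Σ_j (1/i) log U_j‖ ≤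
ε Σ_j dist1 U_j` on families within `dist1 < δ`); (P4) THE PRIMED SLOT `PrintedUV3V' N L := ∃ 𝔞 (_ : AvgAdmissible₃ N 𝔞) (𝔗 : TFamilyA₃ N 𝔞), PrintedUV3G N L (runObjects₀A N 𝔞 𝔗
(Backgrounds.ofAvg N L 𝔞))` (Lean spells n08-a's `′` as `'`).

THE ONE LOCATED DESIGN DEVIATION FROM THE DRAFT (worded on the bus before filing).  n08-a's (P3) states (14) ON `𝔞` through a torus linear block average `linAvgTorus` with the
contour system as a parameter (their §1b) — objects the tree does not have on the torus.  Print ITSELF axiomatizes one level down: [Balaban1987RG1] p. 253 lists the «essential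
properties» (0.5)–(0.9) of the small-loop average `M` and defines `Ū` from `M` by (0.4); p. 254 «It is possible to axiomatize them also».  THIS MODULE TYPES THAT LIST: (0.5) inversion,
(0.6) (conjugations), (0.7) permutations = the fields of the tree's `LoopAverage` (so BY TYPE), (0.9) `G`-valuedness = the codomain, (0.8) linearization = `LoopLinearised` (the one
substantive field), and the block averaging is (0.4)'s (`blockAvgStd`, the geometry S1 already uses).  CONSEQUENCES, SAID: (i) §1b is dissolved (the contour system is (0.4)'s); (ii)
[Balaban1985Averaging]'s block-level (14) for such `𝔞` is the chain rule through (0.4) — LOCATED, untyped (it needs the torus linear average; successor, if a consumer wants it);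
(iii) the arrow of (C2) is CHEAP AND PAID: print's own `exp[mean log]` satisfies (0.8) EXACTLY on its guard (`loopLinearised_expMeanLogSU`: `coe_expMeanLogSU_E` + (26) + `mlog_exp`),
hence `avgAdmissible₃_avOfPrint` and `printedUV3V'_of_printedUV3V` (∃-intro, the B10 side literally n08-a's §8∕§9 `rfl` bridges); (iv) the AXIAL ∕ decimation averaging of the closed d = 3
lane = `avOfLoop (LoopAverage.trivial _)` (`E ≡ 1`) FAILS (0.8) — kernel form `discrete_of_loopLinearised_trivial`: (0.8) for `E ≡ 1` would make `SU(N)` DISCRETE at the identity (`log 1 = 0` against `(1/i) log U`, with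
`|U − 1| ≤ e^{|log U|} − 1 ≤ 2|log U|`) — n08-a's design point 2, now at the `M` level; so (R-b) is honesty, not a supplier (R451 (D): the lane's END along `stdAvg` does not
instantiate the primed slot); (v) print's class is WIDER than this predicate in one respect, SAID:
[Balaban1985Averaging] (42)∕(15) averages ONE contour per site (no `Γ′`, one ordering) — a (0.4)-shape with a different loop family, not typed on the torus; the tree's S1 averaging
`avOfPrint` = [Balaban1987RG1] (0.4) IS in the class.  Measurability of `(𝔞 S j).avg`: NOT a field ((C1)); for `avOfPrint` it is the theorem `BlockAveraging.measurable_avgFun … 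
measurable_expMeanLogSU_E`, and every supplier proves it for its member.

WHAT N08 READS HERE (count-neutral): nothing re-pointed — the `b10` leaf of every record predicate still reads S1 `PrintedUV3V N θ.L` (`CarriersB10.leaf_b10_iff_…`, `Record10Carriers`,
`Record10CarriersB8`); the primed slot is a SIDE face `PrintedUV3V N L → PrintedUV3V' N L` until a re-key is worded (R451 (C2) «from adoption the N08 count line reads PrintedUV3V′»:
the census twins' primed instances are n08-a's (P5), their trigger t10).  HONEST FRAMING: definitions + kernel bookkeeping; NO estimate; nothing of Bałaban's asserted; N08 NOT
discharged; counts unmoved; one finite T⁴ programme at fixed ε — NOT continuum ∕ ℝ⁴ ∕ infinite volume ∕ OS ∕ mass gap ∕ Clay.  No `sorry`, no `axiom`, no `opaque`, no `instance`,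
no `notation`.
-/

noncomputable section

open MeasureTheory

namespace Literature.MathematicalPhysics.QuantumFieldTheory.Balaban1983to89.Node00

open T4Continuum AveragingRT T4FiniteEpsInhabited DagBinding T4AveragingDisintegration
open Balaban1985CMP102 Balaban1985CMP102.Setting Balaban1985CMP102.Theorems B10RunsOfRecord B10Eq2DensityTower
open MatrixLog B7BlockAvgLog ExpMeanLog
open scoped Matrix.Norms.L2Operator

/-! ## §1. The class print quantifies over: averaging families, transformation families along them, the (0.4)-shape family of a small-loop average -/

section Families

variable (N : ℕ) [NeZero N] (L : ℕ)

/-- **An AVERAGING FAMILY on the d = 3 lattices of the [B10] runs** (n08-a's (P1)): one `Setup.Averaging` — gauge covariant ([Balaban1985Averaging] (11) p. 19) and local in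
the standing range BY TYPE — per lattice approximation `S : Scales L` and level `j`.  The class [Balaban1985UV3] p. 256 L10 quantifies over («the averaging operations
described in [1,4]»). [cite: Balaban1985UV3, (2) p.256; Balaban1985Averaging, (11) p.19] -/
abbrev AvgFamily₃ : Type := ∀ S : Scales L, ∀ j, Averaging S.P j (SU N)

variable {L} in
/-- **A VERSION FAMILY of (2) along an averaging family `𝔞`** (n08-a's (P2)): per approximation and level, a renormalization transform `Setup.RTOpI` of
[Balaban1985Averaging] (10) along `𝔞 S j`. [cite: Balaban1985UV3, (2) p.256; Balaban1985Averaging, (10) p.19] -/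
abbrev TFamilyA₃ (𝔞 : AvgFamily₃ N L) : Type := ∀ S : Scales L, ∀ j, RTOpI S.P j (SU N) (𝔞 S j)

/-- The slot of record's version family IS the version family along print's averaging (`rfl`). [cite: Balaban1985UV3, (2) p.256 (bookkeeping)] -/
theorem TFamily₃_eq_TFamilyA₃_avOfPrint : TFamily₃ N L = TFamilyA₃ N (avOfPrint N (L := L)) := rfl

/-- **THE (0.4)-SHAPE AVERAGING FAMILY OF A SMALL-LOOP AVERAGE `ℰ`**: the tree's block averaging `blockAvgStd` ([Balaban1987RG1] (0.4): the loop variables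
`U(Γ ∪ [x,x′] ∪ (−Γ′) ∪ (−c))` over all orderings, averaged by `ℰ`, times `U(c)`; axial beyond the standing range) on every lattice of the runs.  Print's own
`exp[mean log]` gives `avOfPrint` (`avOfLoop_expMeanLogSU`); the TRIVIAL loop average `E ≡ 1` gives the axial ∕ decimation averaging. [cite: Balaban1987RG1, (0.4) p.253; Balaban1985Averaging, (42) p.23] -/
def avOfLoop (ℰ : LoopAverage (SU N)) : AvgFamily₃ N L :=
  fun S j => blockAvgStd S.P (SU N) ℰ j

/-- `avOfLoop expMeanLogSU = avOfPrint` (`rfl`): print's averaging IS the (0.4)-shape family of print's `exp[mean log]`. [cite: Balaban1987RG1, (0.4) p.253 (bookkeeping)] -/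
theorem avOfLoop_expMeanLogSU : avOfLoop N L expMeanLogSU = avOfPrint N (L := L) := rfl

end Families

/-! ## §2. The admissibility predicate: [Balaban1987RG1]'s axiom (0.8) — LINEARIZATION — on the small-loop average (the one substantive printed axiom not in the types) -/

section Admissible

variable (N : ℕ) [NeZero N]

/-- **(0.8) LINEARIZATION, FIRST ORDER, for a small-loop average `ℰ` on `SU(N)`** — [Balaban1987RG1] p. 253: *«for a set {U_j} of elements close to the identity of the
group, i.e. U_j = exp iA_j with A_j in a small neighborhood of 0 in 𝔤, the average is close to the identity also, and (1/i) log M({exp iA_j}) = (1/n) Σ_{j=1}^{n} A_j +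
(higher order terms)»* — read in the principal-logarithm chart `A_j := (1/i) log U_j` (so `U_j = exp iA_j` exactly) with «higher order terms» = `o(Σ_j |U_j − 1|)`: for every
`ε > 0` there is `δ > 0` such that on every nonempty finite family within `dist1 < δ` of the identity, `‖(1/i) log ℰ{U_j} − (1/n) Σ_j (1/i) log U_j‖ ≤ ε · Σ_j dist1 U_j`.
The companion printed axioms are carried BY TYPE: (0.5) inversion, (0.6) (conjugations), (0.7) permutations = the fields of `LoopAverage`; (0.9) `G`-valuedness =
the codomain; gauge covariance (11) and locality of the induced block averaging = the fields of `Setup.Averaging`.  NOT encoded (tree DIVERGENCE F4∕F6 of `BlockAveraging`):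
`Gᶜ`-valuedness ∕ analyticity, the two-sided (0.6). [cite: Balaban1987RG1, (0.8) p.253; Balaban1985Averaging, (14) p.19–20 (the block-level linearization it induces through (0.4)∕(42))] -/
def LoopLinearised (ℰ : LoopAverage (SU N)) : Prop :=
  ∀ ε : ℝ, 0 < ε → ∃ δ : ℝ, 0 < δ ∧ ∀ {m : ℕ} (W : Fin (m + 1) → SU N), (∀ j, GaugeGroup.dist1 (W j) < δ) →
    ‖(Complex.I⁻¹ : ℂ) • mlog ((ℰ.E W : SU N) : Matrix (Fin N) (Fin N) ℂ) -
        ∑ j, ((m + 1 : ℕ) : ℝ)⁻¹ • ((Complex.I⁻¹ : ℂ) • mlog ((W j : SU N) : Matrix (Fin N) (Fin N) ℂ))‖ ≤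
      ε * ∑ j, GaugeGroup.dist1 (W j)

/-- **THE ADMISSIBILITY PREDICATE OF THE PRIMED SLOT** (n08-a's (P3), typed at the level print axiomatizes — the small-loop average `M` of [Balaban1987RG1] p. 253 «It is
possible to axiomatize them also, listing all essential properties» —, chair R451 (C1): exactly the printed axioms, each with its locator; NO measurability field (not in
print), NO exact Haar-compatibility field (E6′ is not in print)): an averaging family `𝔞` is ADMISSIBLE when it is the (0.4)-shape family of a small-loop average `ℰ` on `SU(N)`
((0.5)–(0.7), (0.9) by type) satisfying (0.8). [cite: Balaban1987RG1, (0.4)–(0.9) p.253, p.254 («equally good … many other definitions»); Balaban1985Averaging, (11) + (14) pp.19–20; Balaban1985UV3, p.256 L10] -/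
def AvgAdmissible₃ {L : ℕ} (𝔞 : AvgFamily₃ N L) : Prop :=
  ∃ ℰ : LoopAverage (SU N), LoopLinearised N ℰ ∧ 𝔞 = avOfLoop N L ℰ

variable {N}

/-- **PRINT'S OWN `exp[mean log]` SATISFIES (0.8) — EXACTLY** (no higher-order terms): on its guard `dist1 < δ_N = min(1/3, π/N)` the tree's `expMeanLogSU.E{U_j} =
exp[i Σ_j n⁻¹ (1/i) log U_j]` (`ExpMeanLog.coe_expMeanLogSU_E`) and `‖Σ_j n⁻¹ (1/i) log U_j‖ < ln 2` ((26): `‖log U‖ < ln 2` for `‖U − 1‖ ≤ 1/3`), so `log exp` returns the exponent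
(`B7BlockAvgLog.mlog_exp`) and the difference in (0.8) VANISHES. [cite: Balaban1987RG1, (0.8) p.253 (for the printed (0.4)); Balaban1985Averaging, (21)–(26) pp.21–22] -/
theorem loopLinearised_expMeanLogSU : LoopLinearised N (expMeanLogSU (n := Fin N)) := by
  intro ε hε
  refine ⟨deltaSU (Fin N), deltaSU_pos, fun {m} W hW => ?_⟩
  have hsmall : ∀ j, ‖((W j : SU N) : Matrix (Fin N) (Fin N) ℂ) - 1‖ < deltaSU (Fin N) := hW
  have hE : (((expMeanLogSU (n := Fin N)).E W : SU N) : Matrix (Fin N) (Fin N) ℂ) =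
      NormedSpace.exp (Complex.I • ∑ i, ((m + 1 : ℕ) : ℝ)⁻¹ • ((Complex.I⁻¹ : ℂ) • mlog ((W i : SU N) : Matrix (Fin N) (Fin N) ℂ))) :=
    coe_expMeanLogSU_E W hW
  -- the exponent is small: each `(1/i) log W_j` has norm `< ln 2`, hence so does their mean
  have hlog : ∀ j, ‖(Complex.I⁻¹ : ℂ) • mlog ((W j : SU N) : Matrix (Fin N) (Fin N) ℂ)‖ < Real.log 2 := fun j => by
    rw [norm_smul, norm_inv, Complex.norm_I, inv_one, one_mul]
    exact norm_mlog_lt_log_two (lt_third_of_lt_deltaSU (hsmall j)).le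
  have hmean : ‖∑ i, ((m + 1 : ℕ) : ℝ)⁻¹ • ((Complex.I⁻¹ : ℂ) • mlog ((W i : SU N) : Matrix (Fin N) (Fin N) ℂ))‖ < Real.log 2 := by
    have h := norm_meanLog_lt (ι := Fin (m + 1)) hlog
    rw [Fintype.card_fin] at h
    have hcast : (((m + 1 : ℕ) : ℂ))⁻¹ • ∑ i, (Complex.I⁻¹ : ℂ) • mlog ((W i : SU N) : Matrix (Fin N) (Fin N) ℂ) =
        ∑ i, ((m + 1 : ℕ) : ℝ)⁻¹ • ((Complex.I⁻¹ : ℂ) • mlog ((W i : SU N) : Matrix (Fin N) (Fin N) ℂ)) := by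
      rw [Finset.smul_sum]
      refine Finset.sum_congr rfl fun i _ => ?_
      rw [← Complex.ofReal_natCast, ← Complex.ofReal_inv, Complex.coe_smul]
    rw [hcast] at h
    exact h
  have hexp : ‖Complex.I • ∑ i, ((m + 1 : ℕ) : ℝ)⁻¹ • ((Complex.I⁻¹ : ℂ) • mlog ((W i : SU N) : Matrix (Fin N) (Fin N) ℂ))‖ < Real.log 2 := by
    rw [norm_smul, Complex.norm_I, one_mul]; exact hmean
  rw [hE, mlog_exp hexp, smul_smul, inv_mul_cancel₀ Complex.I_ne_zero, one_smul, sub_self, norm_zero]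
  exact mul_nonneg hε.le (Finset.sum_nonneg fun j _ => GaugeGroup.dist1_nonneg _)

variable (N) in
/-- **PRINT'S AVERAGING IS ADMISSIBLE** (the price of R451 (C2)'s arrow, paid): `avOfPrint N = avOfLoop expMeanLogSU` with (0.8) by `loopLinearised_expMeanLogSU`.
[cite: Balaban1987RG1, (0.4)–(0.8) p.253; Balaban1985UV3, (2) p.256] -/
theorem avgAdmissible₃_avOfPrint (L : ℕ) : AvgAdmissible₃ N (avOfPrint N (L := L)) :=
  ⟨expMeanLogSU, loopLinearised_expMeanLogSU, (avOfLoop_expMeanLogSU N L).symm⟩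

end Admissible

/-! ## §3. The primed slot and the arrow from the slot of record -/

section Slot

variable (N : ℕ) [NeZero N] (L : ℕ)

/-- **THE PRIMED [B10] SLOT `PrintedUV3V′`** (n08-a's (P4); chair R451 (R-b) with (C1)–(C4)): [Balaban1985UV3] Thm 1 (compact reading) ∧ Thm 2 WITH THEIR PRINTED ∃-PREFIX
(`B10RunsOfRecord.PrintedUV3G`) along SOME ADMISSIBLE averaging family `𝔞` of print's axiomatic class, SOME version family of (10) along it, on SU(N), print's [B11] minimisers
READ AT `𝔞` (`Backgrounds.ofAvg`, n08-a's §9′).  BESIDE the slot of record `PrintedUV3V` (S1, `CarriersB10` :125), which stays as typed and implies it (`printedUV3V'_of_printedUV3V`).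
TYPED, NOT ASSERTED. [cite: Balaban1985UV3, Thm 1 p.257, Thm 2 p.272, p.256 L10; Balaban1987RG1, (0.4)–(0.9) p.253, p.254; Balaban1985Variational, Thm 1 p.279] -/
def PrintedUV3V' : Prop :=
  ∃ (𝔞 : AvgFamily₃ N L) (_ : AvgAdmissible₃ N 𝔞) (𝔗 : TFamilyA₃ N 𝔞), PrintedUV3G N L (runObjects₀A N 𝔞 𝔗 (Backgrounds.ofAvg N L 𝔞))

/-- **R451 (C2)'s ARROW `PrintedUV3V → PrintedUV3V′`**: ∃-introduction at `𝔞 := avOfPrint N` (admissible by `avgAdmissible₃_avOfPrint`), the B10 side `Iff.rfl` through n08-a's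
`runObjects₀A_avOfPrint` ∕ `Backgrounds.ofAvg_avOfPrint`.  So every S1-supplier supplies the primed slot, and S1 remains the stronger sufficient face.
[cite: Balaban1985UV3, Thm 1 p.257, Thm 2 p.272 (bookkeeping)] -/
theorem printedUV3V'_of_printedUV3V (h : PrintedUV3V N L) : PrintedUV3V' N L := by
  obtain ⟨𝔗, h𝔗⟩ := h
  exact ⟨avOfPrint N, avgAdmissible₃_avOfPrint N L, 𝔗, h𝔗⟩

variable {N L} in
/-- **SUPPLIER FACE at any admissible member**: the printed theorems along an admissible `𝔞` at some version give the primed slot (∃-introduction).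
[cite: Balaban1985UV3, Thm 1 p.257, Thm 2 p.272 (bookkeeping)] -/
theorem printedUV3V'_of_printedUV3G {𝔞 : AvgFamily₃ N L} (h𝔞 : AvgAdmissible₃ N 𝔞) (𝔗 : TFamilyA₃ N 𝔞)
    (h : PrintedUV3G N L (runObjects₀A N 𝔞 𝔗 (Backgrounds.ofAvg N L 𝔞))) : PrintedUV3V' N L :=
  ⟨𝔞, h𝔞, 𝔗, h⟩


/-- **THE AXIAL ∕ DECIMATION AVERAGING IS NOT IN THE CLASS** (n08-a's design point 2 in kernel form, at the level of `M`): if the TRIVIAL small-loop average `E ≡ 1` — whose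
(0.4)-shape family `avOfLoop (LoopAverage.trivial _)` is the axial averaging of the closed d = 3 lane (`BlockAveraging.avgFun_trivial`) — satisfied (0.8), then EVERY `U ∈ SU(N)`
close enough to the identity would BE the identity (`(1/i) log 1 = 0` against `(1/i) log U`, and `|U − 1| ≤ e^{|log U|} − 1 ≤ 2|log U|`): `SU(N)` would be discrete at `1`, which
it is not for `N ≥ 2`.  So the lane's END along `stdAvg` does not instantiate the primed slot (R451 (D): (R-b) is honesty, not a supplier).
[cite: Balaban1987RG1, (0.8) p.253 (bookkeeping: the decimation «average» violates the printed linearization)] -/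
theorem discrete_of_loopLinearised_trivial {N : ℕ} [NeZero N] (h : LoopLinearised N (LoopAverage.trivial (SU N))) :
    ∃ δ : ℝ, 0 < δ ∧ ∀ U : SU N, GaugeGroup.dist1 U < δ → U = 1 := by
  obtain ⟨δ, hδ, hδ'⟩ := h (1 / 4) (by norm_num)
  refine ⟨min δ (1 / 3), lt_min hδ (by norm_num), fun U hU => ?_⟩
  have hUδ : GaugeGroup.dist1 U < δ := lt_of_lt_of_le hU (min_le_left _ _)
  have hU3 : ‖((U : SU N) : Matrix (Fin N) (Fin N) ℂ) - 1‖ < 1 / 3 := lt_of_lt_of_le hU (min_le_right _ _)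
  have h1 := hδ' (m := 0) (fun _ => U) (fun _ => hUδ)
  have hE : (((LoopAverage.trivial (SU N)).E (fun _ : Fin (0 + 1) => U) : SU N) : Matrix (Fin N) (Fin N) ℂ) = 1 := rfl
  rw [hE, mlog_one, smul_zero, zero_sub, norm_neg, Fin.sum_univ_one, Fin.sum_univ_one, Nat.cast_one, inv_one, one_smul, norm_smul, norm_inv,
    Complex.norm_I, inv_one, one_mul] at h1
  -- `h1 : ‖log U‖ ≤ ¼ · |U − 1|`; and `|U − 1| = |e^{log U} − 1| ≤ e^{‖log U‖} − 1 ≤ 2‖log U‖`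
  change ‖mlog ((U : SU N) : Matrix (Fin N) (Fin N) ℂ)‖ ≤ 1 / 4 * ‖((U : SU N) : Matrix (Fin N) (Fin N) ℂ) - 1‖ at h1
  set x : ℝ := ‖((U : SU N) : Matrix (Fin N) (Fin N) ℂ) - 1‖ with hx
  have hx0 : 0 ≤ x := norm_nonneg _
  have hlog1 : ‖mlog ((U : SU N) : Matrix (Fin N) (Fin N) ℂ)‖ ≤ 1 := by linarith
  have hexp : x ≤ Real.exp ‖mlog ((U : SU N) : Matrix (Fin N) (Fin N) ℂ)‖ - 1 := by
    have h2 := Literature.Analysis.Calculus.norm_exp_sub_one_le (mlog ((U : SU N) : Matrix (Fin N) (Fin N) ℂ))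
    rwa [exp_mlog (lt_trans hU3 (by norm_num))] at h2
  have h3 : Real.exp ‖mlog ((U : SU N) : Matrix (Fin N) (Fin N) ℂ)‖ - 1 ≤ 2 * ‖mlog ((U : SU N) : Matrix (Fin N) (Fin N) ℂ)‖ := by
    have h4 := Real.abs_exp_sub_one_le (x := ‖mlog ((U : SU N) : Matrix (Fin N) (Fin N) ℂ)‖) (by rw [abs_of_nonneg (norm_nonneg _)]; exact hlog1)
    rw [abs_of_nonneg (norm_nonneg _)] at h4
    exact le_trans (le_abs_self _) h4
  have hxz : x = 0 := by nlinarith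
  have hU1 : ((U : SU N) : Matrix (Fin N) (Fin N) ℂ) = 1 := by
    rwa [hx, norm_sub_eq_zero_iff] at hxz
  exact Subtype.ext hU1

end Slot

/-! ## §4 (v1.1). THE AXIAL LANE IS EXCLUDED — closed kernel form for `N ≥ 2` -/

section AxialExcluded

open NormedSpace

/-- **`SU(N)` IS NOT DISCRETE AT THE IDENTITY for `N ≥ 2`** (the fact `discrete_of_loopLinearised_trivial` contradicts): for every `δ > 0` there is `U ∈ SU(N)`, `U ≠ 1`,
with `dist1 U = ‖U − 1‖ < δ` — `U := exp(sX)` for the traceless skew-adjoint generator `X = E₀₁ − E₁₀` (unitary by `exp(−sX) exp(sX) = 1`, `det = e^{s·tr X} = 1` by Liouville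
`Literature.Analysis.Matrix.det_exp_eq_exp_trace`), `s := min(¼, δ∕4)∕‖X‖`: `‖exp(sX) − 1‖ ≤ e^{‖sX‖} − 1 ≤ 2‖sX‖ ≤ δ∕2`, and `U ≠ 1` because `log exp(sX) = sX ≠ 0 = log 1`
(`B7BlockAvgLog.mlog_exp`, `‖sX‖ ≤ ¼ < ln 2`). [folklore] -/
private theorem exists_ne_one_near_one_SU {N : ℕ} [NeZero N] (hN : 2 ≤ N) {δ : ℝ} (hδ : 0 < δ) :
    ∃ U : SU N, U ≠ 1 ∧ GaugeGroup.dist1 U < δ := by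
  letI : NormedAlgebra ℚ (Matrix (Fin N) (Fin N) ℂ) := NormedAlgebra.restrictScalars ℚ ℂ _
  let i₀ : Fin N := ⟨0, by omega⟩
  let i₁ : Fin N := ⟨1, by omega⟩
  have h01 : i₀ ≠ i₁ := by simp [i₀, i₁, Fin.ext_iff]
  let X : Matrix (Fin N) (Fin N) ℂ := Matrix.single i₀ i₁ 1 - Matrix.single i₁ i₀ 1
  have hXstar : star X = -X := by
    rw [Matrix.star_eq_conjTranspose]
    simp only [X, Matrix.conjTranspose_sub, Matrix.conjTranspose_single, star_one, neg_sub]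
  have hXtr : X.trace = 0 := by
    simp only [X, Matrix.trace_sub, Matrix.trace_single_eq_of_ne _ _ _ h01, Matrix.trace_single_eq_of_ne _ _ _ h01.symm, sub_zero]
  have hX0 : X ≠ 0 := by
    intro h0
    have := congrFun (congrFun h0 i₀) i₁
    simp only [X, Matrix.sub_apply, Matrix.single_apply_same, Matrix.zero_apply, Matrix.single_apply_of_row_ne h01.symm] at this
    norm_num at this
  have hXpos : 0 < ‖X‖ := norm_pos_iff.2 hX0
  -- the small parameter
  set s : ℝ := min (1 / 4) (δ / 4) / ‖X‖ with hs
  have hs0 : 0 < s := div_pos (lt_min (by norm_num) (by linarith)) hXpos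
  have hsX : ‖(s : ℂ) • X‖ = min (1 / 4) (δ / 4) := by
    rw [norm_smul, Complex.norm_real, Real.norm_of_nonneg hs0.le, hs, div_mul_cancel₀ _ hXpos.ne']
  have hsX1 : ‖(s : ℂ) • X‖ ≤ 1 / 4 := by rw [hsX]; exact min_le_left _ _
  have hsXδ : ‖(s : ℂ) • X‖ ≤ δ / 4 := by rw [hsX]; exact min_le_right _ _
  -- the element
  have hstar : star ((s : ℂ) • X) = -((s : ℂ) • X) := by
    rw [star_smul, hXstar, smul_neg, Complex.star_def, Complex.conj_ofReal]
  have hunit : exp ((s : ℂ) • X) ∈ Matrix.unitaryGroup (Fin N) ℂ := by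
    rw [Matrix.mem_unitaryGroup_iff, star_exp, hstar, ← exp_add_of_commute (Commute.refl _).neg_right, add_neg_cancel, exp_zero]
  have hdet : (exp ((s : ℂ) • X)).det = 1 := by
    rw [Literature.Analysis.Matrix.det_exp_eq_exp_trace, Matrix.trace_smul, hXtr, smul_zero, exp_zero]
  have hSU : exp ((s : ℂ) • X) ∈ Matrix.specialUnitaryGroup (Fin N) ℂ := Matrix.mem_specialUnitaryGroup_iff.2 ⟨hunit, hdet⟩
  refine ⟨⟨exp ((s : ℂ) • X), hSU⟩, ?_, ?_⟩
  · -- `U ≠ 1`: `log exp (sX) = sX ≠ 0 = log 1`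
    intro hU
    have hU' : exp ((s : ℂ) • X) = (1 : Matrix (Fin N) (Fin N) ℂ) := congrArg Subtype.val hU
    have hlog : mlog (exp ((s : ℂ) • X)) = (s : ℂ) • X := mlog_exp (lt_of_le_of_lt hsX1 (by
      have := Real.log_two_gt_d9; norm_num at this ⊢; linarith))
    rw [hU', mlog_one] at hlog
    have : (s : ℂ) • X = 0 := hlog.symm
    rw [smul_eq_zero] at this
    rcases this with hs' | hX'
    · exact absurd (by exact_mod_cast hs' : s = 0) hs0.ne'
    · exact hX0 hX'
  · -- `dist1 U = ‖exp (sX) − 1‖ ≤ e^{‖sX‖} − 1 ≤ 2‖sX‖ ≤ δ/2 < δ`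
    show ‖exp ((s : ℂ) • X) - 1‖ < δ
    have h1 := Literature.Analysis.Calculus.norm_exp_sub_one_le ((s : ℂ) • X)
    have h2 : Real.exp ‖(s : ℂ) • X‖ - 1 ≤ 2 * ‖(s : ℂ) • X‖ := by
      have h4 := Real.abs_exp_sub_one_le (x := ‖(s : ℂ) • X‖) (by rw [abs_of_nonneg (norm_nonneg _)]; linarith)
      rw [abs_of_nonneg (norm_nonneg _)] at h4
      exact le_trans (le_abs_self _) h4
    linarith


/-- **THE TRIVIAL SMALL-LOOP AVERAGE `E ≡ 1` (the axial ∕ decimation averaging of the closed d = 3 lane) VIOLATES [Balaban1987RG1] (0.8) on `SU(N)`, `N ≥ 2`** — so it is NOT a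
member of the admissible class through `ℰ := LoopAverage.trivial _`, and a supplier at the primed slot along the axial lane would have to exhibit ANOTHER linearised `ℰ` with the
same (0.4)-shape family (none is known): n08-a's design point 2 and chair R454 rail (ii) «EXCLUDES the axial lane» in closed kernel form (`discrete_of_loopLinearised_trivial` + the private
witness `exists_ne_one_near_one_SU`: `SU(N)`, `N ≥ 2`, is not discrete at `1` — `exp(s(E₀₁ − E₁₀))`). [cite: Balaban1987RG1, (0.8) p.253 (bookkeeping: the decimation «average» violates the printed linearization)] -/
theorem not_loopLinearised_trivial {N : ℕ} [NeZero N] (hN : 2 ≤ N) : ¬ LoopLinearised N (LoopAverage.trivial (SU N)) := by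
  intro h
  obtain ⟨δ, hδ, hδ'⟩ := discrete_of_loopLinearised_trivial h
  obtain ⟨U, hU1, hUδ⟩ := exists_ne_one_near_one_SU hN hδ
  exact hU1 (hδ' U hUδ)

end AxialExcluded

end Literature.MathematicalPhysics.QuantumFieldTheory.Balaban1983to89.Node00

end
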